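/-
Copyright (c) 2026 the pub-hodgecm-mathlib formalisation cell (harness21).  Prover seat hodgecm-mathlib-F0P2-p06 (g10): road «S3-tree» (LEAD F0P3a-plan (g11), architect
A-p16 (g29) ruling A-78: «SPAN-0 re-centred at the standard hyperspecial level `K_std`»), 2026-09-01.
-/
import Literature.NumberTheory.Rogawski1990.UnitaryVertexStabilizerSpanSelfDualCM   -- ★ p846029 F0P2-p06 (g10): `span_isSelfDual`, the self-dual cover; brings SpanCM, FILE A, FrameChange
import Literature.NumberTheory.Automorphic.UnitaryLatticeTreeSelfDualFrames           -- ★ T1c (B-p14 (g35)): `exists_frame_of_isSelfDualLattice` (rank-`N` self-dual transitivity at `J₀`)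
import Literature.NumberTheory.Automorphic.LinearAlgebraicGroups                      -- ★ `diagonalGL`, `coe_diagonalGL`
import HarnessLib

/-!
# «SPAN-0» RE-CENTRED: at a non-split unramified place of good reduction the pieces may be taken supported in the STANDARD level `K_std = U(H′)(𝒪_v)` and
# `Ad(K_std)`-invariant — the head `span_isSelfDual_std` (Rogawski 1990 §4.9 Lemma 4.9.3; Bruhat–Tits 1972 §10)

Topic `NumberTheory/Rogawski1990`; namespace `Literature.NumberTheory.Rogawski1990`.  THEOREMS ONLY (no definition, no instance, no notation, no named fact, no `sorry`); kernel
lane.  Cell `pub/hodgecm-mathlib` (D-0151), crux H413 = `stmt-HodgeConjecture-24833`; road «S3-tree», architect A-p16 (g29) ruling A-78 (on reader ref5 (g0) R-48 (iii)): the END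
contract's «SPAN» stub loses its `IsVertexStab` datum — the pieces live on `K_std := cmLocalIntegralLevel L 3 H′ v`, the hypotheses frame of T3′ ∕ T4′ ∕ O8.
THE MATHEMATICS.  ★ `span_isSelfDual` (p846029) cuts `φ` into pieces `g′_k` supported in stabilisers `K_k` of SELF-DUAL vertices `latt g_k` of `(L_w³, H′_w)`.  At an unramified
`w` of GOOD REDUCTION, `U(H′_w)` is TRANSITIVE on self-dual vertices (§1): by the good-reduction frame ★ `H′_w = (σ_w T)ᵀ J₀ T`, `T ∈ GL₃(𝒪_w)`, and ★ T1c
`exists_frame_of_isSelfDualLattice` (`M′ = k·latt(diag d)`, `k ∈ K₀`, `d` σ-fixed with `d_i d_{rev i} = 1`, so `diag d ∈ U(J₀)` by ★ `diagonalGL_mem_unitaryGroupOfForm`), every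
self-dual `M` is `e(x)·𝒪_w³` for some `x ∈ U(H′)(L⁺_v)`; hence `K_k = x_k K_std x_k⁻¹` (§2: `u ∈ K_std ↔ e(u)·𝒪_w³ = 𝒪_w³`, ★ `mem_localIntegralLevel_iff_of_smul_eq` + ★
`mapGL_stdLattice_eq_iff`), and the RE-CENTRED pieces `g_k := g′_k ∘ Ad(x_k)` are smooth (★ `isLocSmooth_comp_conj`), supported in `K_std`, `Ad(K_std)`-invariant, with the SAME
`Δ`-weighted orbital sums: class by class, `Δ(γH, c) ≠ 0` forces `c` regular for `G`-regular `γH` (★ `isRegularElt_of_isLocalNormPair`) and then `Φ(c, g ∘ Ad x) = Φ(c, g)` (★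
`classOrbitalIntegral_comp_conj`).  HEAD (§3) **`span_isSelfDual_std`**: hypotheses of ★ `span_isSelfDual`; conclusion `∃ n g, (∀ k, IsLocSmooth (g k)) ∧ (∀ k, tsupport (g k) ⊆
K_std) ∧ (∀ k, ∀ u ∈ K_std, ∀ x, g k (u x u⁻¹) = g k x) ∧ ∃ V ∈ 𝓝 1, ∀ γH ∈ V, IsLocalGRegular → Σᶠ_c Δ·Φ(c, φ) = Σ_k Σᶠ_c Δ·Φ(c, g k)`.
HONEST LABEL: HC_CM is proved only modulo the 2 remaining named inputs (hLiu418 24832, h413 24833) until rung 0 closes; nothing printed is asserted here; S3 (`stub_N6nsS3id`)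
stays a print row until the road's END lands.

* §1 `exists_unitary_mapGL_stdLattice_eq_of_isSelfDualLattice_antidiagonal` (`J₀`, any `N`), **`exists_local_mapGL_stdLattice_eq_of_isSelfDualLattice`** (`H′_w`, CM currency).
* §2 **`mem_cmLocalIntegralLevel_iff_mapGL_stdLattice_eq`** (`K_std = Stab(𝒪_w³)`), `tsupport_comp_conj_subset_preimage`.
* §3 **`span_isSelfDual_std`**.

## References
* [Rogawski1990] J. D. Rogawski, *Automorphic Representations of Unitary Groups in Three Variables*, Ann. of Math. Stud. 123 (1990), §4.9 pp. 54–56 (Lemma 4.9.3).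
* [BruhatTits1972] F. Bruhat, J. Tits, *Groupes réductifs sur un corps local I*, Publ. Math. IHÉS 41 (1972), §10.
* [Jacobowitz1962] R. Jacobowitz, *Hermitian forms over local fields*, Amer. J. Math. 84 (1962), §7 Thm. 7.1 (unimodular lattices are isometric: transitivity).
* [LanglandsShelstad1990Descent] R. Langlands, D. Shelstad, *Descent for transfer factors* (1990), §2.1.
-/

set_option autoImplicit false

noncomputable section

open scoped Valued WithZero Matrix MatrixGroups
open Topology Set NumberField IsDedekindDomain Matrix

namespace Literature.NumberTheory.Rogawski1990

open Literature.NumberTheory.Automorphic Literature.NumberTheory.Automorphic.UnitaryGroup Literature.NumberTheory.GaloisRepresentations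
open Literature.NumberTheory.Automorphic.UnitaryLatticeTree Literature.NumberTheory.Automorphic.HermitianLattice

/-! ## §1 Self-dual transitivity: every self-dual vertex is `e(x)·𝒪³` -/

section SelfDualTransitive

variable {K : Type*} [Field K] [Valued K ℤᵐ⁰] {σ : K →+* K} {ϖ : K} {N : ℕ}

/-- **`U(σ, J₀)` IS TRANSITIVE ON SELF-DUAL VERTICES** (unramified datum, any `N`): every self-dual `M` is `u·𝒪^N` with `u ∈ U(σ, J₀)` — ★ T1c's frame `M = k·latt(diag d)` with
`diag d ∈ U(σ, J₀)`. [cite: Jacobowitz1962, §7 Thm. 7.1] [cite: BruhatTits1972, §10] -/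
theorem exists_unitary_mapGL_stdLattice_eq_of_isSelfDualLattice_antidiagonal (hd : UnramifiedLocalConjDatum σ ϖ) {ϖ' : K}
    {M : Submodule 𝒪[K] (Fin N → K)} (hM : IsSelfDualLattice σ ϖ' ((StdForm.antidiagonal N).over K) M) :
    ∃ u : unitaryGroupOfForm σ ((StdForm.antidiagonal N).over K), mapGL (u : GL (Fin N) K) (stdLattice K N) = M := by
  obtain ⟨k, -, d, hdσ, hdinv, hMk⟩ := exists_frame_of_isSelfDualLattice hd hM
  have hd0 : ∀ i, d i ≠ 0 := fun i h0 => by have := hdinv i; rw [h0, zero_mul] at this; exact zero_ne_one this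
  set w : Fin N → Kˣ := fun i => Units.mk0 (d i) (hd0 i) with hw
  have hwσ : ∀ i, σ (w i) = w i := fun i => hdσ i
  have hwinv : ∀ i, (w i : K) * w (Fin.rev i) = 1 := fun i => hdinv i
  refine ⟨k * ⟨diagonalGL (Fin N) K w, diagonalGL_mem_unitaryGroupOfForm (σ := σ) hwσ hwinv⟩, ?_⟩
  rw [Subgroup.coe_mul, mapGL_mul, hMk]
  rfl

end SelfDualTransitive

section CM

variable (L : Type) [Field L] [NumberField L] [IsCMField L] (H' : Matrix (Fin 3) (Fin 3) L) (v : HeightOneSpectrum (𝓞 ↥(maximalRealSubfield L)))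
  (w : PlacesOver L v) (hw : IsCMField.complexConj L • w.1 = w.1)

/-- **SELF-DUAL TRANSITIVITY AT `H′_w`** (`v` non-split, unramified; `H′` `c`-hermitian with good reduction at `w`): every self-dual vertex `M` of `(L_w³, σ_w, H′_w)` is
`e(x)·𝒪_w³` for some `x ∈ U(H′)(L⁺_v)` (frame `H′_w = (σ_w T)ᵀ J₀ T`, `T ∈ GL₃(𝒪_w)`; transitivity at `J₀`; `T⁻¹·𝒪³ = 𝒪³`). [cite: Jacobowitz1962, §7 Thm. 7.1] [cite: BruhatTits1972, §10] -/
theorem exists_local_mapGL_stdLattice_eq_of_isSelfDualLattice (hH' : (H'.map (cmConjRingHom L))ᵀ = H') (hv : Algebra.IsUnramifiedIn (𝓞 L) v.asIdeal)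
    (hH'w : IsUnit (placeForm H' w.1)) (hH'i : hH'w.unit ∈ glInt 3 (w.1.adicCompletion L))
    {ϖ : w.1.adicCompletion L} {M : Submodule 𝒪[w.1.adicCompletion L] (Fin 3 → w.1.adicCompletion L)}
    (hM : IsSelfDualLattice (galAdicCompletionMap (L := L) (IsCMField.complexConj L) hw) ϖ (placeForm H' w.1) M) :
    ∃ x : (cmDatum L 3 H').Local v,
      mapGL ((localNonsplitEquiv (IsCMField.complexConj L) H' (IsCMField.complexConj_ne_one L) w hw x :
          ↥(unitaryGroupOfForm (galAdicCompletionMap (L := L) (IsCMField.complexConj L) hw) (placeForm H' w.1))) :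
        GL (Fin 3) (w.1.adicCompletion L)) (stdLattice (w.1.adicCompletion L) 3) = M := by
  set e := localNonsplitEquiv (IsCMField.complexConj L) H' (IsCMField.complexConj_ne_one L) w hw with he
  obtain ⟨ϖ₀, hd⟩ := unramifiedLocalConjDatum_adicCompletion (IsCMField.complexConj L) (IsCMField.complexConj_ne_one L) v w hw hv
  obtain ⟨T, hTint, hT⟩ := exists_glInt_placeForm_eq_formCongr_antidiagonal_of_isUnramifiedIn (↥(maximalRealSubfield L)) L (IsCMField.complexConj L)
    (IsCMField.complexConj_ne_one L) 3 H' hH' v w hw hv hH'w hH'i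
  -- `T·M` is self-dual for `J₀`, hence `u₀·𝒪³`
  have hM' : IsSelfDualLattice (galAdicCompletionMap (L := L) (IsCMField.complexConj L) hw) ϖ
      (formCongr (galAdicCompletionMap (L := L) (IsCMField.complexConj L) hw) T ((StdForm.antidiagonal 3).over (w.1.adicCompletion L))) M := by
    rw [← hT]; exact hM
  obtain ⟨u₀, hu₀⟩ := exists_unitary_mapGL_stdLattice_eq_of_isSelfDualLattice_antidiagonal hd ((isSelfDualLattice_formCongr_iff T _ M).1 hM')
  -- `T⁻¹ u₀ T ∈ U(H′_w)` and `T⁻¹·𝒪³ = 𝒪³`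
  have hmem : T⁻¹ * (u₀ : GL (Fin 3) (w.1.adicCompletion L)) * T ∈
      unitaryGroupOfForm (galAdicCompletionMap (L := L) (IsCMField.complexConj L) hw) (placeForm H' w.1) := by
    rw [hT, ← conj_mem_unitaryGroupOfForm_iff]
    rw [show T * (T⁻¹ * (u₀ : GL (Fin 3) (w.1.adicCompletion L)) * T) * T⁻¹ = (u₀ : GL (Fin 3) (w.1.adicCompletion L)) by group]
    exact u₀.2
  have hTstd : mapGL T (stdLattice (w.1.adicCompletion L) 3) = stdLattice (w.1.adicCompletion L) 3 := by
    rw [mapGL_stdLattice_eq_iff]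
    have h := (mem_glInt_iff _).1 hTint
    rw [forall_mem_integer_iff_isIntMatrix, forall_mem_integer_iff_isIntMatrix] at h
    exact h
  refine ⟨e.symm ⟨_, hmem⟩, ?_⟩
  rw [he, ContinuousMulEquiv.apply_symm_apply]
  change mapGL (T⁻¹ * (u₀ : GL (Fin 3) (w.1.adicCompletion L)) * T) (stdLattice (w.1.adicCompletion L) 3) = M
  rw [mapGL_mul, hTstd, mapGL_mul, hu₀, mapGL_inv_mapGL]

/-! ## §2 `K_std = U(H′)(𝒪_v)` is the stabiliser of the root `𝒪_w³`; supports under conjugation -/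

/-- **`K_std` IS THE STABILISER OF `𝒪_w³`**: `u ∈ cmLocalIntegralLevel L 3 H′ v ↔ e(u)·𝒪_w³ = 𝒪_w³` (non-split `v`: ★ `mem_localIntegralLevel_iff_of_smul_eq`, ★
`mapGL_stdLattice_eq_iff`). [cite: BruhatTits1972, §10] [cite: Rogawski1990, §4.9 p. 54] -/
theorem mem_cmLocalIntegralLevel_iff_mapGL_stdLattice_eq (u : (cmDatum L 3 H').Local v) :
    u ∈ cmLocalIntegralLevel L 3 H' v ↔
      mapGL ((localNonsplitEquiv (IsCMField.complexConj L) H' (IsCMField.complexConj_ne_one L) w hw u :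
          ↥(unitaryGroupOfForm (galAdicCompletionMap (L := L) (IsCMField.complexConj L) hw) (placeForm H' w.1))) :
        GL (Fin 3) (w.1.adicCompletion L)) (stdLattice (w.1.adicCompletion L) 3) = stdLattice (w.1.adicCompletion L) 3 := by
  rw [mapGL_stdLattice_eq_iff]
  refine (mem_localIntegralLevel_iff_of_smul_eq (IsCMField.complexConj L) 3 H' (IsCMField.complexConj_ne_one L) w hw u).trans ?_
  rw [mem_glInt_iff, forall_mem_integer_iff_isIntMatrix, forall_mem_integer_iff_isIntMatrix]

/-- Supports under conjugation: if `y ∈ tsupport (x ↦ f (a y a⁻¹))` then `a y a⁻¹ ∈ tsupport f` (continuity of `Ad a`). [cite: Rogawski1990, §4.9 p. 54] -/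
theorem tsupport_comp_conj_subset_preimage (f : (cmDatum L 3 H').Local v → ℂ) (a y : (cmDatum L 3 H').Local v)
    (hy : y ∈ tsupport (fun z => f (a * z * a⁻¹))) : a * y * a⁻¹ ∈ tsupport f := by
  have hcont : Continuous fun z : (cmDatum L 3 H').Local v => a * z * a⁻¹ := (continuous_const.mul continuous_id).mul continuous_const
  have hsub : tsupport (fun z => f (a * z * a⁻¹)) ⊆ (fun z => a * z * a⁻¹) ⁻¹' tsupport f := by
    rw [tsupport, tsupport, show (Function.support fun z => f (a * z * a⁻¹)) = (fun z => a * z * a⁻¹) ⁻¹' Function.support f from rfl]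
    exact hcont.closure_preimage_subset _
  exact hsub hy

/-! ## §3 «SPAN-0» re-centred at `K_std` -/

section Span

variable [iM' : ∀ γ : (cmDatum L 3 H').Local v, MeasurableSpace ((cmDatum L 3 H').Local v ⧸ Subgroup.centralizer ({γ} : Set ((cmDatum L 3 H').Local v)))]
  [iB' : ∀ γ : (cmDatum L 3 H').Local v, BorelSpace ((cmDatum L 3 H').Local v ⧸ Subgroup.centralizer ({γ} : Set ((cmDatum L 3 H').Local v)))]

/-- **«SPAN-0» RE-CENTRED AT `K_std`** (A-78): at a non-split place `v` UNRAMIFIED in `L` where `H′` has GOOD REDUCTION, every `φ ∈ C_c^∞(U(H′)(L⁺_v))` has finitely many pieces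
`g k`, each smooth, supported in `K_std = cmLocalIntegralLevel L 3 H′ v` and `Ad(K_std)`-invariant, with `Σᶠ_c Δ(γH, out c)·Φ(c, φ) = Σ_k Σᶠ_c Δ·Φ(c, g k)` for all `G`-regular `γH`
near `1` (★ `span_isSelfDual`, re-centred by §1's `x_k` with `K_k = x_k K_std x_k⁻¹`; orbital integrals by ★ `classOrbitalIntegral_comp_conj` on the regular = `Δ ≠ 0` classes).
This is the END-contract stub «SPAN» WITHOUT `IsVertexStab`. [cite: Rogawski1990, §4.9 Lemma 4.9.3 p. 56] [cite: LanglandsShelstad1990Descent, §2.1] [cite: BruhatTits1972, §10] -/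
theorem span_isSelfDual_std (hw : IsCMField.complexConj L • w.1 = w.1) (hH' : (H'.map (cmConjRingHom L))ᵀ = H') (hdet' : H'.det ≠ 0) (hv : Algebra.IsUnramifiedIn (𝓞 L) v.asIdeal)
    (hH'w : IsUnit (placeForm H' w.1)) (hH'i : hH'w.unit ∈ glInt 3 (w.1.adicCompletion L))
    (T : LocalTransferFactor L H' v) {mG : OrbitalMeasureFamily ((cmDatum L 3 H').Local v)}
    (hmG : mG.IsAdmissibleOn fun γ' => IsRegularElt (γ'.val : GL (Fin 3) (LocalRing L v)))
    (φ : (cmDatum L 3 H').Local v → ℂ) (hφ : IsLocSmooth φ) :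
    ∃ (n : ℕ) (g : Fin n → (cmDatum L 3 H').Local v → ℂ),
      (∀ k, IsLocSmooth (g k)) ∧ (∀ k, tsupport (g k) ⊆ (cmLocalIntegralLevel L 3 H' v : Set ((cmDatum L 3 H').Local v))) ∧
      (∀ k, ∀ u ∈ cmLocalIntegralLevel L 3 H' v, ∀ x, g k (u * x * u⁻¹) = g k x) ∧
      ∃ V ∈ 𝓝 (1 : (cmDatum L 2 (Matrix.of fun i j : Fin 2 => if i.val + j.val + 1 = 2 then (1 : L) else 0)).Local v ×
          (cmDatum L 1 (Matrix.of fun i j : Fin 1 => if i.val + j.val + 1 = 1 then (1 : L) else 0)).Local v),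
        ∀ γH ∈ V, IsLocalGRegular L v γH →
          (∑ᶠ c : ConjClasses ((cmDatum L 3 H').Local v), T.Δ γH (Quotient.out c) * classOrbitalIntegral mG φ c) =
            ∑ k, ∑ᶠ c : ConjClasses ((cmDatum L 3 H').Local v), T.Δ γH (Quotient.out c) * classOrbitalIntegral mG (g k) c := by
  -- the one-place model, re-typed on the `cmDatum` carrier so that `map_mul` runs in one rendering of the group law (as in ★ `span_of_cover`)
  obtain ⟨E, hE⟩ : ∃ E : (cmDatum L 3 H').Local v ≃ₜ* ↥(unitaryGroupOfForm (galAdicCompletionMap (L := L) (IsCMField.complexConj L) hw) (placeForm H' w.1)),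
      ∀ g, ((E g : ↥(unitaryGroupOfForm (galAdicCompletionMap (L := L) (IsCMField.complexConj L) hw) (placeForm H' w.1))) : GL (Fin 3) (w.1.adicCompletion L)) =
        ((localNonsplitEquiv (IsCMField.complexConj L) H' (IsCMField.complexConj_ne_one L) w hw g :
          ↥(unitaryGroupOfForm (galAdicCompletionMap (L := L) (IsCMField.complexConj L) hw) (placeForm H' w.1))) : GL (Fin 3) (w.1.adicCompletion L)) :=
    ⟨localNonsplitEquiv (IsCMField.complexConj L) H' (IsCMField.complexConj_ne_one L) w hw, fun _ => rfl⟩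
  obtain ⟨ϖ, hϖ⟩ := exists_uniformizer_adicCompletion L v w
  obtain ⟨n, K, g', hK, hsm, hts, hinv, V, hV, hsumΦ⟩ := span_isSelfDual L H' v w hw hH' hdet' hv hH'w hH'i hϖ T hmG φ hφ
  -- the self-dual vertices behind the stabilisers, and the re-centring elements `x k`
  choose gk hsd _hKc _hKo hKmem using hK
  have hx : ∀ k, ∃ x : (cmDatum L 3 H').Local v,
      mapGL ((localNonsplitEquiv (IsCMField.complexConj L) H' (IsCMField.complexConj_ne_one L) w hw x :
          ↥(unitaryGroupOfForm (galAdicCompletionMap (L := L) (IsCMField.complexConj L) hw) (placeForm H' w.1))) : GL (Fin 3) (w.1.adicCompletion L))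
        (stdLattice (w.1.adicCompletion L) 3) = latt (gk k : Matrix (Fin 3) (Fin 3) (w.1.adicCompletion L)) :=
    fun k => exists_local_mapGL_stdLattice_eq_of_isSelfDualLattice L H' v w hw hH' hv hH'w hH'i (hsd k)
  choose x hxk using hx
  -- `K k = x_k K_std x_k⁻¹`, in the form we need: `x y x⁻¹ ∈ K k ↔ y ∈ K_std`
  have hconj : ∀ k (y : (cmDatum L 3 H').Local v), x k * y * (x k)⁻¹ ∈ K k ↔ y ∈ cmLocalIntegralLevel L 3 H' v := by
    intro k y
    rw [hKmem k, mem_cmLocalIntegralLevel_iff_mapGL_stdLattice_eq L H' v w hw, ← hxk k, ← hE (x k * y * (x k)⁻¹), map_mul, map_mul, map_inv,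
      Subgroup.coe_mul, Subgroup.coe_mul, Subgroup.coe_inv, hE, hE]
    exact mapGL_conj_mapGL_eq_iff _ _ _
  refine ⟨n, fun k y => g' k (x k * y * (x k)⁻¹), fun k => isLocSmooth_comp_conj (hsm k) (x k), fun k y hy => ?_, fun k u hu y => ?_, V, hV, fun γH hγV hγreg => ?_⟩
  · -- support in `K_std`
    exact (hconj k y).1 (hts k (tsupport_comp_conj_subset_preimage L H' v (g' k) (x k) y hy))
  · -- `Ad(K_std)`-invariance
    have hxu : x k * u * (x k)⁻¹ ∈ K k := (hconj k u).2 hu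
    have := hinv k _ hxu (x k * y * (x k)⁻¹)
    rw [show x k * u * (x k)⁻¹ * (x k * y * (x k)⁻¹) * (x k * u * (x k)⁻¹)⁻¹ = x k * (u * y * u⁻¹) * (x k)⁻¹ by group] at this
    exact this
  · -- the `Δ`-weighted sums, class by class
    rw [hsumΦ γH hγV hγreg]
    refine Finset.sum_congr rfl fun k _ => finsum_congr fun c => ?_
    by_cases hΔ : T.Δ γH (Quotient.out c) = 0
    · rw [hΔ, zero_mul, zero_mul]
    · have hR : IsLocalNormPair L H' v γH (Quotient.out c) := by
        by_contra hn; exact hΔ (T.eq_zero_of_not_rel _ _ hn)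
      rw [classOrbitalIntegral_comp_conj L H' v hmG c (isRegularElt_of_isLocalNormPair L H' v hR hγreg) (g' k) (x k)]

end Span

end CM

end Literature.NumberTheory.Rogawski1990

end
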